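/-
Copyright (c) 2026 the pub-hodgecm-mathlib formalisation cell (harness21).  Prover seat hodgecm-mathlib-K2E5-p04 (g3), HCML Track B «K2-LIT» (build stream 29),
h413 = `stmt-HodgeConjecture-24833`, line `K2_E3_EllipticInputs`, unit U12 «Characters», socket #11 road (11-SC), letter (SC-an), END-GAME MAP v3 (line lead
K2E3-p14 (g3), `K2/STATUS.md` 2026-09-04T02:48:50Z), piece [M6′] «EXPLICIT Bset» (RULINGS #4 (R4-1)), FILE B (CARRIER SIDE): the companion of ★ [M6] `K2E3SupercuspidalTruncatedCharLimCanc` in which the split-regular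
ball is the pull-back of an EXPLICIT height ball of the field model (FILE A `K2E3SupercuspidalTruncatedCharRadiusDatum`), and `hball` is reduced to a model inequality.  2026-09-04.
-/
import Summits.HodgeConjecture.HodgeConjecture.Theorems.K2E3SupercuspidalTruncatedCharRadiusDatum      -- ★ [M6′] FILE A (this seat): `exists_radius_and_datum` (model side); brings ★ [M6], ★ (M5d), ★ (D2), ★ [M4], ★ [M5′], ★ [M2a], ★ (f2), ★ p856390, ★ p856355
import HarnessLib

/-!
# h413 ∕ Track B «K2-LIT», line `K2_E3_EllipticInputs`, unit U12, road (11-SC), letter (SC-an) — piece [M6′] «EXPLICIT Bset»: THE SPLIT-REGULAR BALL OF [M6] AS THE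
# PULL-BACK OF THE HEIGHT BALL `Ω_M (5 m_C + 3 s + 1)` OF A CHOSEN DATUM `(t, d, λ, y₀)`, AND `hball` REDUCED TO A MODEL INEQUALITY
# (Harish-Chandra 1970, Part VII §3 p. 71 eq. (1), (ii), p. 72; Theorem 20; Cor. of Theorem 18)

Cell `pub/hodgecm-mathlib`, crux H413 = `stmt-HodgeConjecture-24833`, route of record `HCCMUnconditional`; chair K2-lead (g0), dealer K2E3-plan (g2), (SC-an) line lead K2E3-p14 (g3)
(END-GAME MAP v3 + RULINGS #4 (R4-1), 2026-09-04T02:48:50Z: «[M6′] EXPLICIT Bset … and export the reduction `hball_of_model_bound`»).  THEOREMS ONLY (no `def`, no `instance`,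
no `notation`, no named-fact hypothesis, no `sorry`); lane `--supports stmt-HodgeConjecture-24833 --as helper`, count-neutral.

WHY.  ★ [M6] inhabits the `hlim`∕`hcanc` binders of the (SC-an) consumers (★ p856184 ∕ ★ p856355) on `G = (cmDatum L 3 H).Local v` with an OPAQUE radius `R(g)` (★ [M4]'s `∃ R`),
enough for the limit half; but the DOMINATION brick `hball : ∫_{Bset g} ‖θ(x g x⁻¹)‖ ≤ W g` of ★ p856355 must be proved for THE SAME `Bset`, so the radius has to be pinned to
the (SC-dom) currency.  Along a field model `e : G ≃ₜ* M = U(σ_w, Φ₃)(L_w)` (★ (f2)) with height balls `Ω_M` (★ p856390, given here as INPUT with `hmem` `hinv` `hmul` so that the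
(SC-dom) assembler states his model inequality against the same object) THIS FILE chooses, for every `g ∈ G` with `e g` REGULAR and `Z_G(g)` NOT compact, a datum
`t = diag d` (★ [M2a] FILE B (d)), the MINIMAL depth `λ` (`∀ i ≠ k, |ϖ^λ| ≤ |dᵢ − dₖ|`), the MINIMAL height `m_g` (`e g ∈ Ω_M m_g`, Mathlib `CompactExhaustion.find`) and a
conjugator `y₀ ∈ Ω_M (2m_g + 2λ)` with `e g = y₀ t y₀⁻¹` (★ (D2a)), and sets
  `R(g) := 5·m_C + 3·s + 1`,  `m_C := 2m_θ + 2λ` (★ (D2b): `supp f_t ⊆ Ω_M m_C · T`),  `s := 2m_g + 2λ`,  `Bset g := Ω (R g) = e⁻¹(Ω_M (R g))`,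
`m_θ` = a support height of the transported coefficient `θ_M = B u′ (ρ(e⁻¹ ·) u)`; at REGULAR ELLIPTIC `e g` the radius is the compact-support one of ★ [M6] §2, at singular `e g`
(a null set, ★ [M2a] (e)) it is `0`.  With THIS radius: the shell vanishing (★ (M5d) `setIntegral_sdiff_heightBall_coeff_conj_eq_zero_of_subset`), hence `hcanc`∕`hlim` a.e.
(★ (f1), ★ [M5′] transport, as in ★ [M6]); the datum and its MINIMALITY are EXPORTED (so `m_g`, `λ` are bounded by explicit functions of `g`: any height, resp. ★ (M5e-2)
`v_pow_le_v_sub_of_pow_normAbs_le_token`'s `4τ + 10m`); and `hball`∕`hballE` for `W := W_M ∘ e` are REDUCED to model integrals by the transport identity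
`∫_{e⁻¹ S} ‖θ(x g x⁻¹)‖ dμ = ∫_S ‖θ_M(x′ (e g) x′⁻¹)‖ d(e_* μ)` (★ [M5′] `setIntegral_preimage_coeff_conj_eq`).

HONEST LABEL.  HC_CM is proved only modulo the 7 printed citations (2 remaining named inputs: hLiu418 = `stmt-HodgeConjecture-24832`, h413 = `stmt-HodgeConjecture-24833`)
until rung 0 closes; count-neutral helper: after it the (SC-an) letter at `N = 3` is ★ MODULO the MODEL inequalities behind `hball`, `hballE` ((M5a)(M5b)(M5e-1)(M5f)) and `hW`
((M5g) HC-D-ε), none of which is proved here.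

## References
* [HarishChandra1970] Harish-Chandra (notes by G. van Dijk), *Harmonic Analysis on Reductive p-adic Groups*, LNM 162 (1970), Part VII §2 Theorem 20 p. 70, Cor. of Thm 18 p. 69;
  §3 p. 71 eq. (1), (ii), p. 72; Part I §3 Lemma 14 p. 9; Part V Lemma 42.
* [Rogawski1990] J. D. Rogawski, *Automorphic Representations of Unitary Groups in Three Variables*, Ann. of Math. Stud. 123 (1990), §3.1 p. 19, §3.6 pp. 28–31, §4.9 p. 54,
  §12.2 p. 173, §12.5 p. 182.
* [PlatonovRapinchuk1994] V. Platonov, A. Rapinchuk, *Algebraic Groups and Number Theory* (1994), §5.1.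
* [Folland1995] G. B. Folland, *A Course in Abstract Harmonic Analysis* (1995), §2.4.
-/

set_option autoImplicit false
-- the mandated namespace repeats the single-problem summit's segment (`HodgeConjecture.HodgeConjecture`)
set_option linter.dupNamespace false

noncomputable section

open MeasureTheory Measure Set Filter Topology NumberField IsDedekindDomain
open scoped NNReal ENNReal Pointwise Matrix MatrixGroups WithZero
open ValuativeRel
open Literature.NumberTheory.Automorphic Literature.NumberTheory.Automorphic.UnitaryGroup Literature.NumberTheory.Rogawski1990
open Literature.NumberTheory.GaloisRepresentations

namespace Summit.HodgeConjecture.HodgeConjecture.Cruxes.H413.K2E3SupercuspidalTruncatedCharLimCancExplicit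

/-! ## The carrier `G = (cmDatum L 3 H).Local v` along a field model `e : G ≃ₜ* M`: the explicit exhaustion, radius and ball; the datum exported; `hball` reduced -/

section Carrier

variable (L : Type) [Field L] [NumberField L] [IsCMField L] (H : Matrix (Fin 3) (Fin 3) L)

set_option maxHeartbeats 800000 in
-- the statement is long (six exported clauses on the CM ∕ one-place carriers); default budget runs out in its elaboration (same class as ★ [M2a] FILE B's 800000)
/-- **[M6′] MAIN — EXPLICIT EXHAUSTION AND RADIUS ALONG A FIELD MODEL.**  `G = (cmDatum L 3 H).Local v`, `w ∣ v` fixed by conjugation, `e : G ≃ₜ* M = U(σ_w, Φ₃)(L_w)` ANY isomorphism of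
topological groups (★ (f2) at an isotropic `H_w`), `Ω_M` the height balls of `M` (INPUT, with `hmem` `hinv` `hmul` of ★ p856390), `μ` Haar on `G`, `ρ` smooth SUPERCUSPIDAL with invariant `B`,
`θ = B u′ (ρ(·) u)`, `θ_M = θ ∘ e⁻¹`.  There are `Ω` (`Ω n = e⁻¹ Ω_M n`), a radius `R : G → ℕ` and a support height `m_θ` of `θ_M` such that: (c) for `μ`-a.e. `g`, `∀ n, Θₙ(g) = ∫_{Ω n ∩ Ω (R g)} θ(x g x⁻¹)`
and `Θₙ(g) → Θ_{R g}(g)` (GUARD-FREE); (d) for EVERY `g` with `e g` regular and `Z_G(g)` NOT compact, a DATUM `(t, d, y₀, λ, m_g)` on `M` — `t = diag d` regular, `λ` its MINIMAL depth, `m_g`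
the MINIMAL height of `e g`, `y₀ ∈ Ω_M (2m_g + 2λ)`, `e g = y₀ t y₀⁻¹` — with **`R g = 5(2m_θ + 2λ) + 3(2m_g + 2λ) + 1`**; (e) `e g` is regular for `μ`-a.e. `g`; (f) the transport identity
`∫_{e⁻¹ S} ‖θ(x g x⁻¹)‖ dμ = ∫_S ‖θ_M(x′ (e g) x′⁻¹)‖ d(e_* μ)`.  §1 at `e_* μ` for `ρ_M = ρ ∘ e⁻¹` (generalised in the proof), ★ [M2a] (e) pulled back, ★ (f1), ★ [M5′].
[cite: HarishChandra1970, Part VII §3 p. 71 eq. (1), (ii), p. 72; §2 Theorem 20 p. 70] [cite: Rogawski1990, §12.2 p. 173, §12.5 p. 182] [cite: PlatonovRapinchuk1994, §5.1] [cite: Folland1995, §2.4] -/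
theorem exists_explicit_exhaustion_radius
    {v : HeightOneSpectrum (𝓞 ↥(maximalRealSubfield L))} (w : PlacesOver L v) (hw : IsCMField.complexConj L • w.1 = w.1)
    [MeasurableSpace ((UnitaryGroup.cmDatum L 3 H).Local v)] [BorelSpace ((UnitaryGroup.cmDatum L 3 H).Local v)]
    (μ : Measure ((UnitaryGroup.cmDatum L 3 H).Local v)) [μ.IsHaarMeasure]
    [MeasurableSpace ↥(unitaryGroupOfForm (galAdicCompletionMap (L := L) (IsCMField.complexConj L) hw) ((StdForm.antidiagonal 3).over (w.1.adicCompletion L)))]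
    [BorelSpace ↥(unitaryGroupOfForm (galAdicCompletionMap (L := L) (IsCMField.complexConj L) hw) ((StdForm.antidiagonal 3).over (w.1.adicCompletion L)))]
    (e : (UnitaryGroup.cmDatum L 3 H).Local v ≃ₜ*
      ↥(unitaryGroupOfForm (galAdicCompletionMap (L := L) (IsCMField.complexConj L) hw) ((StdForm.antidiagonal 3).over (w.1.adicCompletion L))))
    (ΩM : CompactExhaustion ↥(unitaryGroupOfForm (galAdicCompletionMap (L := L) (IsCMField.complexConj L) hw) ((StdForm.antidiagonal 3).over (w.1.adicCompletion L))))
    {ϖ : w.1.adicCompletion L} (hϖ : Valued.v ϖ = WithZero.exp (-1 : ℤ))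
    (hmem : ∀ (m : ℕ) (g : ↥(unitaryGroupOfForm (galAdicCompletionMap (L := L) (IsCMField.complexConj L) hw) ((StdForm.antidiagonal 3).over (w.1.adicCompletion L)))),
      g ∈ ΩM m ↔
      (∀ i j, Valued.v (ϖ ^ m * ((g : GL (Fin 3) (w.1.adicCompletion L)) : Matrix (Fin 3) (Fin 3) (w.1.adicCompletion L)) i j) ≤ 1) ∧
        ∀ i j, Valued.v (ϖ ^ m * (((g : GL (Fin 3) (w.1.adicCompletion L))⁻¹ : GL (Fin 3) (w.1.adicCompletion L)) :
          Matrix (Fin 3) (Fin 3) (w.1.adicCompletion L)) i j) ≤ 1)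
    (hinv : ∀ (m : ℕ) (g : ↥(unitaryGroupOfForm (galAdicCompletionMap (L := L) (IsCMField.complexConj L) hw) ((StdForm.antidiagonal 3).over (w.1.adicCompletion L)))),
      g ∈ ΩM m → g⁻¹ ∈ ΩM m)
    (hmul : ∀ (a b : ℕ) (g h : ↥(unitaryGroupOfForm (galAdicCompletionMap (L := L) (IsCMField.complexConj L) hw) ((StdForm.antidiagonal 3).over (w.1.adicCompletion L)))),
      g ∈ ΩM a → h ∈ ΩM b → g * h ∈ ΩM (a + b))
    {V : Type*} [AddCommGroup V] [Module ℂ V] (ρ : Representation ℂ ((UnitaryGroup.cmDatum L 3 H).Local v) V) (hsm : ρ.IsSmooth) (hsc : ρ.IsSupercuspidal)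
    (B : V →ₗ⋆[ℂ] V →ₗ[ℂ] ℂ) (hBinv : ∀ (g : (UnitaryGroup.cmDatum L 3 H).Local v) (x y : V), B (ρ g x) (ρ g y) = B x y) (u u' : V) :
    ∃ (Ω : CompactExhaustion ((UnitaryGroup.cmDatum L 3 H).Local v)) (R : (UnitaryGroup.cmDatum L 3 H).Local v → ℕ) (mθ : ℕ),
      (∀ n : ℕ, (Ω n : Set ((UnitaryGroup.cmDatum L 3 H).Local v)) = e ⁻¹' (ΩM n)) ∧
      (∀ m' : ↥(unitaryGroupOfForm (galAdicCompletionMap (L := L) (IsCMField.complexConj L) hw) ((StdForm.antidiagonal 3).over (w.1.adicCompletion L))),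
        B u' (ρ (e.symm m') u) ≠ 0 → m' ∈ ΩM mθ) ∧
      (∀ᵐ g ∂μ, (∀ n : ℕ, ∫ x in Ω n, B u' (ρ (x * g * x⁻¹) u) ∂μ = ∫ x in Ω n ∩ Ω (R g), B u' (ρ (x * g * x⁻¹) u) ∂μ) ∧
        Tendsto (fun n : ℕ => ∫ x in Ω n, B u' (ρ (x * g * x⁻¹) u) ∂μ) atTop (𝓝 (∫ x in Ω (R g), B u' (ρ (x * g * x⁻¹) u) ∂μ))) ∧
      (∀ g : (UnitaryGroup.cmDatum L 3 H).Local v, IsRegularElt ((e g : ↥(unitaryGroupOfForm (galAdicCompletionMap (L := L) (IsCMField.complexConj L) hw)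
          ((StdForm.antidiagonal 3).over (w.1.adicCompletion L)))) : GL (Fin 3) (w.1.adicCompletion L)) →
        ¬ IsCompact ((Subgroup.centralizer ({g} : Set ((UnitaryGroup.cmDatum L 3 H).Local v))) : Set ((UnitaryGroup.cmDatum L 3 H).Local v)) →
        ∃ (t y₀ : ↥(unitaryGroupOfForm (galAdicCompletionMap (L := L) (IsCMField.complexConj L) hw) ((StdForm.antidiagonal 3).over (w.1.adicCompletion L))))
          (d : Fin 3 → (w.1.adicCompletion L)ˣ) (lam mg : ℕ),
          glDiagonal 3 (w.1.adicCompletion L) d = (t : GL (Fin 3) (w.1.adicCompletion L)) ∧ IsRegularElt (t : GL (Fin 3) (w.1.adicCompletion L)) ∧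
          (∀ i k : Fin 3, i ≠ k → Valued.v (ϖ ^ lam) ≤ Valued.v ((d i : w.1.adicCompletion L) - d k)) ∧
          (∀ lam' : ℕ, (∀ i k : Fin 3, i ≠ k → Valued.v (ϖ ^ lam') ≤ Valued.v ((d i : w.1.adicCompletion L) - d k)) → lam ≤ lam') ∧
          e g ∈ ΩM mg ∧ (∀ m' : ℕ, e g ∈ ΩM m' → mg ≤ m') ∧
          y₀ ∈ ΩM (2 * mg + 2 * lam) ∧ e g = y₀ * t * y₀⁻¹ ∧
          R g = 5 * (2 * mθ + 2 * lam) + 3 * (2 * mg + 2 * lam) + 1) ∧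
      (∀ᵐ g ∂μ, IsRegularElt ((e g : ↥(unitaryGroupOfForm (galAdicCompletionMap (L := L) (IsCMField.complexConj L) hw)
          ((StdForm.antidiagonal 3).over (w.1.adicCompletion L)))) : GL (Fin 3) (w.1.adicCompletion L))) ∧
      (∀ (g : (UnitaryGroup.cmDatum L 3 H).Local v)
        (S : Set ↥(unitaryGroupOfForm (galAdicCompletionMap (L := L) (IsCMField.complexConj L) hw) ((StdForm.antidiagonal 3).over (w.1.adicCompletion L)))),
        ∫ x in e ⁻¹' S, ‖B u' (ρ (x * g * x⁻¹) u)‖ ∂μ = ∫ x' in S, ‖B u' (ρ (e.symm (x' * e g * x'⁻¹)) u)‖ ∂(μ.map e)) := by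
  haveI : (μ.map e).IsHaarMeasure := ContinuousMulEquiv.isHaarMeasure_map μ e
  -- the pulled-back exhaustion (★ [M5′] §1)
  obtain ⟨Ω, hΩ⟩ := K2E3TruncatedCharTransport.exists_compactExhaustion_preimage e.toHomeomorph ΩM
  -- a.e. `e g` is regular (★ [M2a] FILE A (e) at the Haar measure `e_* μ`, pulled back)
  have hregae : ∀ᵐ g ∂μ, IsRegularElt ((e g : ↥(unitaryGroupOfForm (galAdicCompletionMap (L := L) (IsCMField.complexConj L) hw)
      ((StdForm.antidiagonal 3).over (w.1.adicCompletion L)))) : GL (Fin 3) (w.1.adicCompletion L)) :=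
    ae_of_ae_map e.continuous.measurable.aemeasurable (K2E3SupercuspModelFrameAtPlace.ae_isRegularElt_of_eq_over L w hw rfl (μ.map e))
  -- the transport identity (★ [M5′] §2)
  have htrans : ∀ (g : (UnitaryGroup.cmDatum L 3 H).Local v)
      (S : Set ↥(unitaryGroupOfForm (galAdicCompletionMap (L := L) (IsCMField.complexConj L) hw) ((StdForm.antidiagonal 3).over (w.1.adicCompletion L)))),
      ∫ x in e ⁻¹' S, ‖B u' (ρ (x * g * x⁻¹) u)‖ ∂μ = ∫ x' in S, ‖B u' (ρ (e.symm (x' * e g * x'⁻¹)) u)‖ ∂(μ.map e) := fun g S => by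
    have h := K2E3TruncatedCharTransport.setIntegral_preimage_coeff_conj_eq e μ
      (fun m' : ↥(unitaryGroupOfForm (galAdicCompletionMap (L := L) (IsCMField.complexConj L) hw) ((StdForm.antidiagonal 3).over (w.1.adicCompletion L))) =>
        ‖B u' (ρ (e.symm m') u)‖) S g
    simp only [ContinuousMulEquiv.symm_apply_apply] at h
    exact h
  -- GENERALISATION over the transported datum `ρ_M` (instantiated at `ρ ∘ e⁻¹`, ★ [M5′] §3): support height, radius choice (§1), shapes, datum
  suffices key : ∀ ρM : Representation ℂ
      ↥(unitaryGroupOfForm (galAdicCompletionMap (L := L) (IsCMField.complexConj L) hw) ((StdForm.antidiagonal 3).over (w.1.adicCompletion L))) V,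
      ρM.IsSmooth → ρM.IsSupercuspidal → (∀ m (x y : V), B (ρM m x) (ρM m y) = B x y) →
      (∀ m' : ↥(unitaryGroupOfForm (galAdicCompletionMap (L := L) (IsCMField.complexConj L) hw) ((StdForm.antidiagonal 3).over (w.1.adicCompletion L))),
        ρM m' = ρ (e.symm m')) →
      ∃ (R : (UnitaryGroup.cmDatum L 3 H).Local v → ℕ) (mθ : ℕ),
        (∀ m' : ↥(unitaryGroupOfForm (galAdicCompletionMap (L := L) (IsCMField.complexConj L) hw) ((StdForm.antidiagonal 3).over (w.1.adicCompletion L))),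
          B u' (ρ (e.symm m') u) ≠ 0 → m' ∈ ΩM mθ) ∧
        (∀ᵐ g ∂μ, (∀ n : ℕ, ∫ x in Ω n, B u' (ρ (x * g * x⁻¹) u) ∂μ = ∫ x in Ω n ∩ Ω (R g), B u' (ρ (x * g * x⁻¹) u) ∂μ) ∧
          Tendsto (fun n : ℕ => ∫ x in Ω n, B u' (ρ (x * g * x⁻¹) u) ∂μ) atTop (𝓝 (∫ x in Ω (R g), B u' (ρ (x * g * x⁻¹) u) ∂μ))) ∧
        (∀ g : (UnitaryGroup.cmDatum L 3 H).Local v, IsRegularElt ((e g : ↥(unitaryGroupOfForm (galAdicCompletionMap (L := L) (IsCMField.complexConj L) hw)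
            ((StdForm.antidiagonal 3).over (w.1.adicCompletion L)))) : GL (Fin 3) (w.1.adicCompletion L)) →
          ¬ IsCompact ((Subgroup.centralizer ({g} : Set ((UnitaryGroup.cmDatum L 3 H).Local v))) : Set ((UnitaryGroup.cmDatum L 3 H).Local v)) →
          ∃ (t y₀ : ↥(unitaryGroupOfForm (galAdicCompletionMap (L := L) (IsCMField.complexConj L) hw) ((StdForm.antidiagonal 3).over (w.1.adicCompletion L))))
            (d : Fin 3 → (w.1.adicCompletion L)ˣ) (lam mg : ℕ),
            glDiagonal 3 (w.1.adicCompletion L) d = (t : GL (Fin 3) (w.1.adicCompletion L)) ∧ IsRegularElt (t : GL (Fin 3) (w.1.adicCompletion L)) ∧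
            (∀ i k : Fin 3, i ≠ k → Valued.v (ϖ ^ lam) ≤ Valued.v ((d i : w.1.adicCompletion L) - d k)) ∧
            (∀ lam' : ℕ, (∀ i k : Fin 3, i ≠ k → Valued.v (ϖ ^ lam') ≤ Valued.v ((d i : w.1.adicCompletion L) - d k)) → lam ≤ lam') ∧
            e g ∈ ΩM mg ∧ (∀ m' : ℕ, e g ∈ ΩM m' → mg ≤ m') ∧
            y₀ ∈ ΩM (2 * mg + 2 * lam) ∧ e g = y₀ * t * y₀⁻¹ ∧
            R g = 5 * (2 * mθ + 2 * lam) + 3 * (2 * mg + 2 * lam) + 1) by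
    obtain ⟨R, mθ, hθ, hae, hdat⟩ := key _ (K2E3TruncatedCharTransport.isSmooth_comp_continuousMulEquiv_symm e ρ hsm)
      (K2E3TruncatedCharTransport.isSupercuspidal_comp_continuousMulEquiv_symm e ρ hsc)
      (fun m x y => by rw [MonoidHom.comp_apply, MonoidHom.coe_coe]; exact hBinv _ x y)
      (fun m' => by rw [MonoidHom.comp_apply, MonoidHom.coe_coe])
    exact ⟨Ω, R, mθ, hΩ, hθ, hae, hdat, hregae, htrans⟩
  intro ρM hsmM hscM hBinvM hρM
  -- the support height `m_θ` of `θ_M` (compact support: ★ `IsSupercuspidal.hasCompactSupport_sesqForm_apply_apply`, compact centre ★ [M2a] FILE A)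
  have hZc := K2E3SupercuspModelFrameAtPlace.isCompact_center_of_eq_over L w hw (J := (StdForm.antidiagonal 3).over (w.1.adicCompletion L)) rfl
  have hcs : HasCompactSupport fun m' : ↥(unitaryGroupOfForm (galAdicCompletionMap (L := L) (IsCMField.complexConj L) hw) ((StdForm.antidiagonal 3).over (w.1.adicCompletion L))) =>
      B u' (ρM m' u) := hscM.hasCompactSupport_sesqForm_apply_apply hZc hsmM hBinvM u u'
  obtain ⟨mθ, hmθ⟩ := ΩM.exists_superset_of_isCompact hcs.isCompact
  have hθ : ∀ m' : ↥(unitaryGroupOfForm (galAdicCompletionMap (L := L) (IsCMField.complexConj L) hw) ((StdForm.antidiagonal 3).over (w.1.adicCompletion L))),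
      B u' (ρM m' u) ≠ 0 → m' ∈ ΩM mθ := fun m' h => hmθ (subset_tsupport _ (Function.mem_support.2 h))
  -- the radius, element by element on the model (§1), read at `e g`
  choose Rf hRf using fun m' => K2E3SupercuspidalTruncatedCharRadiusDatum.exists_radius_and_datum L w hw (J := (StdForm.antidiagonal 3).over (w.1.adicCompletion L)) rfl (μ.map e) ΩM hϖ hmem hinv hmul
    ρM hsmM hscM B hBinvM u u' hθ m'
  refine ⟨fun g => Rf (e g), mθ, fun m' h => hθ m' (by rw [hρM]; exact h), ?_, fun g hreg hZ => ?_⟩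
  · -- the two shapes, a.e.: shell vanishing at the regular `e g` (§1 (i)), ★ (f1) §4 on `M`, transport ★ [M5′] §2
    filter_upwards [hregae] with g hreg
    have h0 := (hRf (e g)).1 hreg
    have hφ : Continuous fun x : ↥(unitaryGroupOfForm (galAdicCompletionMap (L := L) (IsCMField.complexConj L) hw) ((StdForm.antidiagonal 3).over (w.1.adicCompletion L))) =>
        B u' (ρM (x * e g * x⁻¹) u) := K2E3SupercuspOrbitalSliceCuspidalModel.continuous_coeff_conj _ ρM hsmM B (e g) u u'
    have hmeas : ∀ n : ℕ, MeasurableSet (ΩM n : Set ↥(unitaryGroupOfForm (galAdicCompletionMap (L := L) (IsCMField.complexConj L) hw)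
        ((StdForm.antidiagonal 3).over (w.1.adicCompletion L)))) := fun n => (ΩM.isCompact n).measurableSet
    have hint : ∀ n : ℕ, IntegrableOn (fun x : ↥(unitaryGroupOfForm (galAdicCompletionMap (L := L) (IsCMField.complexConj L) hw)
        ((StdForm.antidiagonal 3).over (w.1.adicCompletion L))) => B u' (ρM (x * e g * x⁻¹) u)) (ΩM n) (μ.map e) :=
      fun n => hφ.continuousOn.integrableOn_compact (ΩM.isCompact n)
    have hcanc := K2E3RightInvariantSetIntegralVanishing.setIntegral_eq_setIntegral_inter_of_sdiff_eq_zero (μ.map e) ΩM hmeas (Rf (e g)) _ hint h0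
    have hlim := K2E3RightInvariantSetIntegralVanishing.tendsto_setIntegral_of_forall_sdiff_eq_zero (μ.map e) ΩM (fun _ _ h => ΩM.subset h) hmeas (Rf (e g)) _ hint h0
    have hT := K2E3TruncatedCharTransport.truncated_eq_inter_and_tendsto_of_map e μ (fun m' => B u' (ρM m' u)) ΩM Ω hΩ g hcanc hlim
    have hρM' : ∀ z : (UnitaryGroup.cmDatum L 3 H).Local v, ρM (e z) = ρ z := fun z => by rw [hρM, ContinuousMulEquiv.symm_apply_apply]
    simp only [hρM'] at hT
    exact hT
  · -- the datum at `e g` (§1 (ii)); ellipticity transports along `e` (★ [M5′] §3)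
    have hZM := mt (K2E3TruncatedCharTransport.isCompact_centralizer_iff_of_continuousMulEquiv e g).2 hZ
    exact (hRf (e g)).2 hreg hZM

set_option maxHeartbeats 800000 in
-- the statement is long (ten exported clauses on the CM ∕ one-place carriers); default budget runs out in its elaboration (same class as ★ [M2a] FILE B's 800000)
/-- **[M6′] IN THE CONSUMERS' BINDERS, WITH THE EXPLICIT BALL AND THE `hball` REDUCTION.**  Along `e : G ≃ₜ* M` as above: a compact exhaustion `Ω` (`= e⁻¹ Ω_M`), a radius `R`, a support
height `m_θ`, `F g := Θ_{R g}(g)` and `Bset g := Ω (R g) = e⁻¹(Ω_M (R g))` (compact) such that `hlim` and `hcanc` of ★ p856184 ∕ ★ p856355 hold TOKEN FOR TOKEN (guard idle), the DATUM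
clause of the MAIN theorem describes `R g` at every `g` with `e g` regular and `Z_G(g)` non-compact, `e g` is regular a.e., and the DOMINATION bricks reduce to MODEL inequalities:
**`hball_of_model_bound`** — for every `W_M : M → ℝ`, if for a.e. `g` off the regular-elliptic set `∫_{Ω_M (R g)} ‖θ_M(x′ (e g) x′⁻¹)‖ d(e_* μ) ≤ W_M (e g)`, then `hball` holds for
`Bset` and `W := W_M ∘ e`; **`hballE_of_model_bound`** — likewise for the full integrals on the regular-elliptic set.  With ★ [M6] §4 (`sigSCan_datum_of_domination_bricks`'s shape)
this pins `Bset` for (SC-dom) to ONE choice: (M5e-1) ∕ (M5f) ∕ (M5h) are now pure MODEL statements about `Ω_M`, `m_θ` and the exported datum.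
[cite: HarishChandra1970, Part VII §3 pp. 70–73; Thms 14, 18–20] [cite: Rogawski1990, §12.2 p. 173, §12.5 p. 182] [cite: Folland1995, §2.4] -/
theorem explicit_limit_localisation_and_hball_reduction
    {v : HeightOneSpectrum (𝓞 ↥(maximalRealSubfield L))} (w : PlacesOver L v) (hw : IsCMField.complexConj L • w.1 = w.1)
    [MeasurableSpace ((UnitaryGroup.cmDatum L 3 H).Local v)] [BorelSpace ((UnitaryGroup.cmDatum L 3 H).Local v)]
    (μ : Measure ((UnitaryGroup.cmDatum L 3 H).Local v)) [μ.IsHaarMeasure]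
    [MeasurableSpace ↥(unitaryGroupOfForm (galAdicCompletionMap (L := L) (IsCMField.complexConj L) hw) ((StdForm.antidiagonal 3).over (w.1.adicCompletion L)))]
    [BorelSpace ↥(unitaryGroupOfForm (galAdicCompletionMap (L := L) (IsCMField.complexConj L) hw) ((StdForm.antidiagonal 3).over (w.1.adicCompletion L)))]
    (e : (UnitaryGroup.cmDatum L 3 H).Local v ≃ₜ*
      ↥(unitaryGroupOfForm (galAdicCompletionMap (L := L) (IsCMField.complexConj L) hw) ((StdForm.antidiagonal 3).over (w.1.adicCompletion L))))
    (ΩM : CompactExhaustion ↥(unitaryGroupOfForm (galAdicCompletionMap (L := L) (IsCMField.complexConj L) hw) ((StdForm.antidiagonal 3).over (w.1.adicCompletion L))))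
    {ϖ : w.1.adicCompletion L} (hϖ : Valued.v ϖ = WithZero.exp (-1 : ℤ))
    (hmem : ∀ (m : ℕ) (g : ↥(unitaryGroupOfForm (galAdicCompletionMap (L := L) (IsCMField.complexConj L) hw) ((StdForm.antidiagonal 3).over (w.1.adicCompletion L)))),
      g ∈ ΩM m ↔
      (∀ i j, Valued.v (ϖ ^ m * ((g : GL (Fin 3) (w.1.adicCompletion L)) : Matrix (Fin 3) (Fin 3) (w.1.adicCompletion L)) i j) ≤ 1) ∧
        ∀ i j, Valued.v (ϖ ^ m * (((g : GL (Fin 3) (w.1.adicCompletion L))⁻¹ : GL (Fin 3) (w.1.adicCompletion L)) :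
          Matrix (Fin 3) (Fin 3) (w.1.adicCompletion L)) i j) ≤ 1)
    (hinv : ∀ (m : ℕ) (g : ↥(unitaryGroupOfForm (galAdicCompletionMap (L := L) (IsCMField.complexConj L) hw) ((StdForm.antidiagonal 3).over (w.1.adicCompletion L)))),
      g ∈ ΩM m → g⁻¹ ∈ ΩM m)
    (hmul : ∀ (a b : ℕ) (g h : ↥(unitaryGroupOfForm (galAdicCompletionMap (L := L) (IsCMField.complexConj L) hw) ((StdForm.antidiagonal 3).over (w.1.adicCompletion L)))),
      g ∈ ΩM a → h ∈ ΩM b → g * h ∈ ΩM (a + b))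
    {V : Type*} [AddCommGroup V] [Module ℂ V] (ρ : Representation ℂ ((UnitaryGroup.cmDatum L 3 H).Local v) V) (hsm : ρ.IsSmooth) (hsc : ρ.IsSupercuspidal)
    (B : V →ₗ⋆[ℂ] V →ₗ[ℂ] ℂ) (hBinv : ∀ (g : (UnitaryGroup.cmDatum L 3 H).Local v) (x y : V), B (ρ g x) (ρ g y) = B x y) (u u' : V) :
    ∃ (Ω : CompactExhaustion ((UnitaryGroup.cmDatum L 3 H).Local v)) (R : (UnitaryGroup.cmDatum L 3 H).Local v → ℕ) (mθ : ℕ)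
      (F : (UnitaryGroup.cmDatum L 3 H).Local v → ℂ) (Bset : (UnitaryGroup.cmDatum L 3 H).Local v → Set ((UnitaryGroup.cmDatum L 3 H).Local v)),
      (∀ n : ℕ, (Ω n : Set ((UnitaryGroup.cmDatum L 3 H).Local v)) = e ⁻¹' (ΩM n)) ∧
      (∀ g, Bset g = e ⁻¹' (ΩM (R g))) ∧ (∀ g, IsCompact (Bset g)) ∧
      -- `hlim` of ★ p856184 and `hcanc` of ★ p856355, token for token
      (∀ᵐ g ∂μ, ¬ (IsRegularElt (g.val : GL (Fin 3) (UnitaryGroup.LocalRing L v)) ∧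
          IsCompact ((Subgroup.centralizer ({g} : Set ((UnitaryGroup.cmDatum L 3 H).Local v))) : Set ((UnitaryGroup.cmDatum L 3 H).Local v))) →
        Tendsto (fun n => ∫ x in Ω n, B u' (ρ (x * g * x⁻¹) u) ∂μ) atTop (𝓝 (F g))) ∧
      (∀ n : ℕ, ∀ᵐ g ∂μ, ¬ (IsRegularElt (g.val : GL (Fin 3) (UnitaryGroup.LocalRing L v)) ∧
          IsCompact ((Subgroup.centralizer ({g} : Set ((UnitaryGroup.cmDatum L 3 H).Local v))) : Set ((UnitaryGroup.cmDatum L 3 H).Local v))) →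
        ∫ x in Ω n, B u' (ρ (x * g * x⁻¹) u) ∂μ = ∫ x in Ω n ∩ Bset g, B u' (ρ (x * g * x⁻¹) u) ∂μ) ∧
      -- support height and the DATUM of the radius
      (∀ m' : ↥(unitaryGroupOfForm (galAdicCompletionMap (L := L) (IsCMField.complexConj L) hw) ((StdForm.antidiagonal 3).over (w.1.adicCompletion L))),
        B u' (ρ (e.symm m') u) ≠ 0 → m' ∈ ΩM mθ) ∧
      (∀ g : (UnitaryGroup.cmDatum L 3 H).Local v, IsRegularElt ((e g : ↥(unitaryGroupOfForm (galAdicCompletionMap (L := L) (IsCMField.complexConj L) hw)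
          ((StdForm.antidiagonal 3).over (w.1.adicCompletion L)))) : GL (Fin 3) (w.1.adicCompletion L)) →
        ¬ IsCompact ((Subgroup.centralizer ({g} : Set ((UnitaryGroup.cmDatum L 3 H).Local v))) : Set ((UnitaryGroup.cmDatum L 3 H).Local v)) →
        ∃ (t y₀ : ↥(unitaryGroupOfForm (galAdicCompletionMap (L := L) (IsCMField.complexConj L) hw) ((StdForm.antidiagonal 3).over (w.1.adicCompletion L))))
          (d : Fin 3 → (w.1.adicCompletion L)ˣ) (lam mg : ℕ),
          glDiagonal 3 (w.1.adicCompletion L) d = (t : GL (Fin 3) (w.1.adicCompletion L)) ∧ IsRegularElt (t : GL (Fin 3) (w.1.adicCompletion L)) ∧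
          (∀ i k : Fin 3, i ≠ k → Valued.v (ϖ ^ lam) ≤ Valued.v ((d i : w.1.adicCompletion L) - d k)) ∧
          (∀ lam' : ℕ, (∀ i k : Fin 3, i ≠ k → Valued.v (ϖ ^ lam') ≤ Valued.v ((d i : w.1.adicCompletion L) - d k)) → lam ≤ lam') ∧
          e g ∈ ΩM mg ∧ (∀ m' : ℕ, e g ∈ ΩM m' → mg ≤ m') ∧
          y₀ ∈ ΩM (2 * mg + 2 * lam) ∧ e g = y₀ * t * y₀⁻¹ ∧
          R g = 5 * (2 * mθ + 2 * lam) + 3 * (2 * mg + 2 * lam) + 1) ∧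
      (∀ᵐ g ∂μ, IsRegularElt ((e g : ↥(unitaryGroupOfForm (galAdicCompletionMap (L := L) (IsCMField.complexConj L) hw)
          ((StdForm.antidiagonal 3).over (w.1.adicCompletion L)))) : GL (Fin 3) (w.1.adicCompletion L))) ∧
      -- `hball_of_model_bound` (★ p856355's `hball` for `W := W_M ∘ e`)
      (∀ W_M : ↥(unitaryGroupOfForm (galAdicCompletionMap (L := L) (IsCMField.complexConj L) hw) ((StdForm.antidiagonal 3).over (w.1.adicCompletion L))) → ℝ,
        (∀ᵐ g ∂μ, ¬ (IsRegularElt (g.val : GL (Fin 3) (UnitaryGroup.LocalRing L v)) ∧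
            IsCompact ((Subgroup.centralizer ({g} : Set ((UnitaryGroup.cmDatum L 3 H).Local v))) : Set ((UnitaryGroup.cmDatum L 3 H).Local v))) →
          ∫ x' in ΩM (R g), ‖B u' (ρ (e.symm (x' * e g * x'⁻¹)) u)‖ ∂(μ.map e) ≤ W_M (e g)) →
        ∀ᵐ g ∂μ, ¬ (IsRegularElt (g.val : GL (Fin 3) (UnitaryGroup.LocalRing L v)) ∧
            IsCompact ((Subgroup.centralizer ({g} : Set ((UnitaryGroup.cmDatum L 3 H).Local v))) : Set ((UnitaryGroup.cmDatum L 3 H).Local v))) →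
          ∫ x in Bset g, ‖B u' (ρ (x * g * x⁻¹) u)‖ ∂μ ≤ W_M (e g)) ∧
      -- `hballE_of_model_bound` (★ p856355's `hballE` for `W := W_M ∘ e`)
      (∀ W_M : ↥(unitaryGroupOfForm (galAdicCompletionMap (L := L) (IsCMField.complexConj L) hw) ((StdForm.antidiagonal 3).over (w.1.adicCompletion L))) → ℝ,
        (∀ᵐ g ∂μ, (IsRegularElt (g.val : GL (Fin 3) (UnitaryGroup.LocalRing L v)) ∧
            IsCompact ((Subgroup.centralizer ({g} : Set ((UnitaryGroup.cmDatum L 3 H).Local v))) : Set ((UnitaryGroup.cmDatum L 3 H).Local v))) →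
          ∫ x', ‖B u' (ρ (e.symm (x' * e g * x'⁻¹)) u)‖ ∂(μ.map e) ≤ W_M (e g)) →
        ∀ᵐ g ∂μ, (IsRegularElt (g.val : GL (Fin 3) (UnitaryGroup.LocalRing L v)) ∧
            IsCompact ((Subgroup.centralizer ({g} : Set ((UnitaryGroup.cmDatum L 3 H).Local v))) : Set ((UnitaryGroup.cmDatum L 3 H).Local v))) →
          ∫ x, ‖B u' (ρ (x * g * x⁻¹) u)‖ ∂μ ≤ W_M (e g)) := by
  obtain ⟨Ω, R, mθ, hΩ, hθ, hae, hdat, hregae, htrans⟩ :=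
    exists_explicit_exhaustion_radius L H w hw μ e ΩM hϖ hmem hinv hmul ρ hsm hsc B hBinv u u'
  have hBset : ∀ g, (Ω (R g) : Set ((UnitaryGroup.cmDatum L 3 H).Local v)) = e ⁻¹' (ΩM (R g)) := fun g => hΩ (R g)
  refine ⟨Ω, R, mθ, fun g => ∫ x in Ω (R g), B u' (ρ (x * g * x⁻¹) u) ∂μ, fun g => Ω (R g), hΩ, hBset, fun g => Ω.isCompact (R g), ?_, fun n => ?_, hθ, hdat,
    hregae, fun W_M hWM => ?_, fun W_M hWM => ?_⟩
  · filter_upwards [hae] with g hg _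
    exact hg.2
  · filter_upwards [hae] with g hg _
    exact hg.1 n
  · filter_upwards [hWM] with g hg hng
    rw [hBset g, htrans g]
    exact hg hng
  · filter_upwards [hWM] with g hg hell
    have h := htrans g Set.univ
    rw [Set.preimage_univ, Measure.restrict_univ, Measure.restrict_univ] at h
    rw [h]
    exact hg hell

end Carrier

end Summit.HodgeConjecture.HodgeConjecture.Cruxes.H413.K2E3SupercuspidalTruncatedCharLimCancExplicit

end
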